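import Literature.AnabelianGeometry.AbsoluteAnabelian.AbsTopILem27HSEdgeMLF
import Literature.NumberTheory.GaloisRepresentations.HOneRepTrivialFamiliesOrder
import HarnessLib

/-!
# [AbsTopI] Thm 2.6 (iii): `δ²_l(J) ≥ 1` from a group-theoretic Lemma 2.7 (ii) datum — the non-split
# Hochschild–Serre route, assembled

S. Mochizuki, *Topics in Absolute Anabelian Geometry I: Generalities* (2012) [AbsTopI], proof of Thm 2.6
(iii), p. 23, second clause, as run at the finite levels `ℤ/lⁱ` in the tree.  For an extension
`1 → Δ → Π → G → 1` with MLF base (`B : E.MLFBase`, `G ≅ G_K`), an open subgroup `J ≤ Π` with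
`N := Δ ∩ J` (so `J/N ≅ G_{K′}`), a prime `l`, and a **Lemma 2.7 (ii)-type datum read on the groups**:

* `K ≤ N`, normal in `J`, with `[J, N] ⊆ K` ("`G_k` acts trivially on `R = T/Ker`", after the
  replacement "`H` acts trivially on the quotient `R`" of p. 23),
* a uniform `c`: every conjugation-invariant continuous homomorphism `K → ℤ/lⁱ` is killed by `l^c`
  (Lemma 2.7 (ii)(c): no nonzero torsion-free subquotient of the kernel with finite action — the
  finite-level defect of Lemma 2.7 (iii)),
* compatible conjugation-invariant continuous homomorphisms `f_i : N → ℤ/lⁱ` killing `K` and taking the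
  value `1` (the reductions of a primitive `ℤ_l`-linear form `r^∨ ∘ π` on `R_l`, `rank R ≥ 1`),
* compatible continuous additive characters `χ_i : J/N → ℤ/lⁱ` taking the value `1` (reductions of a
  primitive unramified `ℤ_l`-character of `G_{K′}`),

the classes `z_i = [ḡ ↦ χ_i(ḡ) · [f_i]] ∈ H¹(J/N, H¹(N, ℤ/lⁱ))` (`hOneRepSmulClass`) form a compatible
family (`hOneRepSmulClass_compatible`) of unbounded order (`exists_nsmul_hOneRepSmulClass_ne_zero`),
hence (`one_le_deltaInv_two_of_hOneRep_family_of_isOpen`: the torsion-tolerant Hochschild–Serre edge,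
`cd G_{K′} = 2`, `#H²(G_{K′}, ℤ/lⁱ) ∣ m`, towers `ℤ/lⁱ → ℤ_l → ℚ_l`) **`1 ≤ δ²_l(J)`**
(`one_le_deltaInv_two_of_lem27Datum`) — the conclusion of `FundamentalExtension.Lem27iiiStep` at
`H′ = J`, WITHOUT the splitting hypothesis of the `(∗)_Σ`-route `lem27iiiStep_of_sigmaStarCondition`.

What remains geometric (GAP row G-w5d058g8-2, campaign L): that the Tate module of the Albanese of
`X_J` furnishes such a datum whenever the rank excess `δ¹_{l₀}(J) − δ¹_{l₀}(G_J)` is positive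
([AbsTopI] Lemma 2.7 (i)(ii) = [AbsAnab] Lemma 1.1.5, and the rank formula of Thm 2.6 (ii)).
HONEST FRAMING: refereed, undisputed; classical Galois cohomology; nothing here bears on [IUTchIII]
Cor. 3.12.

## References
* S. Mochizuki, *Topics in Absolute Anabelian Geometry I* (2012), Thm 2.6 (iii) proof p. 23, Lemma 2.7
  pp. 24–25. [MochizukiAbsTopI2012]
-/

noncomputable section

open CategoryTheory Function Topology

namespace Literature.AnabelianGeometry.AbsoluteAnabelian

open Literature.NumberTheory.GaloisRepresentations
open Literature.NumberTheory.EllipticCurves (subgroupConj subgroupConj_apply_coe)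
open _root_.TopRep _root_.ContRepresentation _root_.ContinuousCohomology Field

namespace FundamentalExtension

variable (E : FundamentalExtension.{0})

/-- **[AbsTopI] Thm 2.6 (iii), proof p. 23, second clause — the non-split Hochschild–Serre route from a
group-theoretic Lemma 2.7 (ii) datum.**  See the module docstring for the datum; conclusion
`1 ≤ deltaInv J 2 l` (`= δ²_l(J) ≥ 1`) for the open subgroup `J ≤ Π` of an extension with MLF base.
The instance arguments are supplied as `isCompact_iff_compactSpace.1 (Subgroup.isClosed_of_isOpen J hJ).isCompact`,
`E.normal_geom.subgroupOf J`, `E.isClosed_geom.preimage continuous_subtype_val`.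
[cite: MochizukiAbsTopI2012, Thm 2.6 (iii) proof p.23] [cite: MochizukiAbsTopI2012, Lemma 2.7 (iii) p.24] -/
theorem one_le_deltaInv_two_of_lem27Datum (B : E.MLFBase) {J : Subgroup E.arith}
    (hJ : IsOpen (J : Set E.arith)) (l : ℕ) [Fact l.Prime]
    [CompactSpace ↥J] [(E.geom.subgroupOf J).Normal]
    [IsClosed ((E.geom.subgroupOf J : Subgroup ↥J) : Set ↥J)]
    -- the datum: `K ≤ N := Δ ∩ J`, normal in `J`, `[J, N] ⊆ K`, uniform defect `l^c`
    (K : Subgroup ↥J) [K.Normal] (hKN : K ≤ E.geom.subgroupOf J)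
    (hJK : ∀ (g : ↥J) (n : ↥J), n ∈ E.geom.subgroupOf J → n⁻¹ * (g⁻¹ * n * g) ∈ K) (c : ℕ)
    (hK : ∀ (i : ℕ) (u : contOneCocycles
      (((ContinuousRep.trivial ↥J ℤ (ZMod (l ^ i))).restrict (subgroupIncl K)).toTopRep)),
      (∀ (g : ↥J) (k : K), u.1 (subgroupConj K g k) = u.1 k) → l ^ c • u = 0)
    -- `f_i : N → ℤ/lⁱ` conjugation-invariant, compatible, killing `K`, primitive
    (f : ∀ i : ℕ, contOneCocycles
      (((ContinuousRep.trivial ↥J ℤ (ZMod (l ^ i))).restrict (subgroupIncl (E.geom.subgroupOf J))).toTopRep))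
    (hf : ∀ i (g : ↥J) (n : E.geom.subgroupOf J), (f i).1 (subgroupConj (E.geom.subgroupOf J) g n) = (f i).1 n)
    (hff : ∀ i (n : E.geom.subgroupOf J),
      (f i).1 n = ZMod.castHom (pow_dvd_pow l (Nat.le_succ i)) (ZMod (l ^ i)) ((f (i + 1)).1 n))
    (hfK : ∀ i (n : E.geom.subgroupOf J), (n : ↥J) ∈ K → (f i).1 n = 0)
    (hf1 : ∀ i, ∃ n : E.geom.subgroupOf J, (f i).1 n = 1)
    -- `χ_i : J/N → ℤ/lⁱ` compatible, primitive
    (χ : ∀ i : ℕ, contOneCocycles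
      (ContinuousRep.trivial (↥J ⧸ E.geom.subgroupOf J) ℤ (ZMod (l ^ i))).toTopRep)
    (hχ : ∀ i q, (χ i).1 q = ZMod.castHom (pow_dvd_pow l (Nat.le_succ i)) (ZMod (l ^ i)) ((χ (i + 1)).1 q))
    (hχ1 : ∀ i, ∃ q, (χ i).1 q = 1) :
    1 ≤ deltaInv ↥J 2 l :=
  E.one_le_deltaInv_two_of_hOneRep_family_of_isOpen B hJ l
    (fun i => hOneRepSmulClass (E.geom.subgroupOf J) l i (χ i) (f i) (hf i))
    (hOneRepSmulClass_compatible (E.geom.subgroupOf J) l χ hχ f hff hf)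
    (exists_nsmul_hOneRepSmulClass_ne_zero (E.geom.subgroupOf J) l K hKN hJK c hK χ hχ1 f hf hfK hf1)

end FundamentalExtension

end Literature.AnabelianGeometry.AbsoluteAnabelian

end
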